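import Literature.MathematicalPhysics.QuantumFieldTheory.Balaban1983to89.Beta.PoissonInterior

/-!
# `BalabanUV.Beta.D1BFx.LatticeHLSRadial` — road «BF-x» for binder row D1, letter (L5) of the gluon needle rows T₁∕T₂∕T₃ (owner spec
# `GLUON-NEEDLE-ROWS.md` v0.1 ∕ ruling ρ-g9-33, claimable «GN-L5 HLS KIT»), PART 1 of 3: RADIAL (ONE-CENTRE) LATTICE SUMS ON `ℤ^d`, UNIFORM
# OVER FINITE SETS, in the `PoissonInterior.nrm = max(1, ‖·‖∞)` currency — windows, critical logs, super-critical tails, scale-`n` DAMPED moments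

HONEST FRAMING (cell contract, verbatim): «discharging `BetaPertH` makes Bałaban's UV stability UNCONDITIONAL — a real constructive-QFT
result; it is NOT the continuum limit and NOT the Clay problem.»  HONEST DEPENDENCY (verbatim): «continuum YM on T⁴ ⇐ BetaPertH ∧ nine
spine estimates (0/9 proved); BetaPertH ⇐ (D1) ∧ (D4) ∧ CAP+tail; G-an2-4 gates asym, D1 and NE2/3/4.»  THIS MODULE DISCHARGES NOTHING
of D1 ∕ BetaPertH: it is [folklore] counting on `ℤ^d` (sup-norm shells; harmonic ∕ geometric ∕ telescoping one-dimensional sums) composed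
BY NAME from `PoissonInterior.{cube, supNorm, nrm, card_shell_le, sum_cube_inv_nrm_pow_le}` and Mathlib (`harmonic_le_one_add_log`,
`Real.pow_div_factorial_le_exp`, `geom_sum_Ico_le_of_lt_one`).  It cites nothing, mints no `Prop`, asserts nothing of Bałaban's papers;
0 binders; (K) NOT closed; NOT D1, NOT BetaPertH, NOT continuum, NOT Clay.
WHY (an3-g57 `N36-SPLIT.v1.md` §3′ (3)–(5), ADOPTED in ρ-g9-33): the T₁∕T₂∕T₃ n-power ledgers use «standard lattice HLS sums; in tree only
`PoissonInterior.sum_cube_inv_nrm_pow_le` — never `sup × sup × count`» and the saturated moment sums `Σ_w |w|²nrm(w)⁻²e^{−δ|w|∕n} ≍ n⁴`,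
`Σ_w|w|²nrm(w)⁻¹e^{…} ≍ n⁵`, `Σ_w |w|² e^{−δ|w|∕n} ≍ n⁶`; (L5) = «a kit of lattice HLS sums (NOT `Zl` at rate 1∕n: +n⁴)».  This part is the
ONE-CENTRE part; `D1BFx.LatticeHLS` (part 2) has the two-centre sums, `D1BFx.LatticeHLSProfiles` (part 3) the packaged kernel∘profile
corollaries, the damping-centre-free sums and the `tsum` ∕ `d = 4` reading.  Every bound is UNIFORM over `S : Finset (Site d)` and the centre.
CONTENT (all [folklore]; `d ≥ 1`; `κ_d := 2d·3^{d−1}` = the shell constant of `PoissonInterior.card_shell_le`).  §1 one-dimensional sums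
(`(2j+1)^k ≤ 3^k j^k`, `Σ_{m≤j≤M} 1∕j² ≤ 2∕m`, `y^k e^{−εy} ≤ k!(2∕ε)^k e^{−εy∕2}`,
`Σ_{j∈T} e^{−εj} ≤ 1 + 1∕ε`, `Σ_{j∈T} j^k e^{−εj} ≤ k!(2∕ε)^k(1+2∕ε)`,
`Σ_{1≤j≤M} e^{−εj}∕j ≤ 1 + log N + (1+2∕ε)∕N`); §2 shells of an ARBITRARY finite set around ANY centre (`card_shell_le'`), radial majorants
`sum_radial_le` ∕ `sum_radial_le₀`; §3 ONE CENTRE: window `Σ_{‖x−u‖∞≤R} nrm(x−u)^{−p} ≤ 1 + κ_d R^{d−p}` (`p ≤ d−1`), critical `p = d`: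
`≤ 1 + κ_d(1 + log R)`, tails `p ≥ d+1`: `Σ_{‖x−u‖∞≥m} ≤ 2κ_d∕m^{p−d}`, whole space `≤ 1 + 2κ_d`; §4 DAMPED (mass `ε`, resp. `δ∕n`):
`Σ ‖x−u‖∞^q e^{−ε‖x−u‖∞} ≤ 1 + κ_d (q+d−1)!(2∕ε)^{q+d−1}(1+2∕ε)` (`≤ 1 + C·n^{q+d}`), `Σ e^{−ε‖x−u‖}∕nrm^p ≤ 1 + κ_d (d−1−p)!(2∕ε)^{d−1−p}(1+2∕ε)`
(`p ≤ d−1`), critical `Σ e^{−(δ∕n)‖x−u‖}∕nrm^d ≤ 1 + κ_d(2 + 2∕δ + log n)`.  Constants explicit and crude.  Unit `b2b-balaban-beta-d1-formalise-leaf-04`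
(gen 9), claim «GN-L5 HLS KIT» (journal 2026-08-21 l.29970).
-/

namespace Summit.QuantumFields.BalabanUV.Beta.D1BFx.LatticeHLSRadial

open Finset Real
open Literature.Probability.LatticeModels (Site)
open Literature.MathematicalPhysics.QuantumFieldTheory.Balaban1983to89.Beta
open PoissonInterior (cube supNorm nrm mem_cube_zero_iff card_shell_le sum_cube_inv_nrm_pow_le supNorm_zero supNorm_eq_zero_iff
  nrm_pos)

variable {d : ℕ}

/-! ## §1 One-dimensional sums -/

/-- [folklore] `(2j+1)^k ≤ 3^k·j^k` for `j ≥ 1`. -/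
theorem two_mul_add_one_pow_le {j : ℕ} (hj : 1 ≤ j) (k : ℕ) : (2 * (j : ℝ) + 1) ^ k ≤ 3 ^ k * (j : ℝ) ^ k := by
  rw [← mul_pow]
  apply pow_le_pow_left₀ (by positivity)
  have : (1 : ℝ) ≤ j := by exact_mod_cast hj
  linarith

/-- [folklore] `Σ_{m≤j≤M} 1∕j² ≤ 2∕m` for `m ≥ 1` (telescoping `1∕j² ≤ 1∕(j−1) − 1∕j`; proved as `≤ 2∕m − 1∕M` by induction). -/
theorem sum_Icc_inv_sq_le {m : ℕ} (hm : 1 ≤ m) (M : ℕ) : ∑ j ∈ Finset.Icc m M, 1 / (j : ℝ) ^ 2 ≤ 2 / (m : ℝ) := by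
  have hm0 : (0 : ℝ) < m := by exact_mod_cast hm
  rcases lt_or_ge M m with hMm | hMm
  · rw [Finset.Icc_eq_empty_of_lt hMm, Finset.sum_empty]; positivity
  · have key : ∀ M, m ≤ M → ∑ j ∈ Finset.Icc m M, 1 / (j : ℝ) ^ 2 ≤ 2 / (m : ℝ) - 1 / (M : ℝ) := by
      intro M hM
      induction M, hM using Nat.le_induction with
      | base =>
          rw [Finset.Icc_self, Finset.sum_singleton]
          have h1 : (1 : ℝ) ≤ m := by exact_mod_cast hm
          rw [show (2 : ℝ) / m - 1 / m = 1 / m by ring, div_le_div_iff₀ (by positivity) hm0]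
          nlinarith
      | succ M hmM ih =>
          have hM0 : (0 : ℝ) < M := by exact_mod_cast (show 0 < M by omega)
          rw [Finset.sum_Icc_succ_top (by omega), Nat.cast_succ]
          have h2 : 1 / ((M : ℝ) + 1) ^ 2 ≤ 1 / (M : ℝ) - 1 / ((M : ℝ) + 1) := by
            rw [show 1 / (M : ℝ) - 1 / ((M : ℝ) + 1) = 1 / ((M : ℝ) * ((M : ℝ) + 1)) by field_simp; ring]
            exact one_div_le_one_div_of_le (by positivity) (by nlinarith)
          linarith
    have h := key M hMm
    have : 0 ≤ 1 / (M : ℝ) := by positivity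
    linarith

/-- [folklore] **One damped power.**  `j^k·e^{−εj} ≤ k!·(2∕ε)^k·e^{−(ε∕2)j}` (`(εj∕2)^k∕k! ≤ e^{εj∕2}`): a moment costs `(2∕ε)^k` and
half the mass. -/
theorem pow_mul_exp_neg_le {ε : ℝ} (hε : 0 < ε) (k : ℕ) {y : ℝ} (hy : 0 ≤ y) :
    y ^ k * Real.exp (-ε * y) ≤ k.factorial * (2 / ε) ^ k * Real.exp (-(ε / 2) * y) := by
  have hfac : (0 : ℝ) < k.factorial := by positivity
  have hx : (0 : ℝ) ≤ ε / 2 * y := by positivity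
  have h1 := Real.pow_div_factorial_le_exp _ hx k
  rw [div_le_iff₀ hfac] at h1
  have h2 : y ^ k = (2 / ε) ^ k * (ε / 2 * y) ^ k := by
    have e : 2 / ε * (ε / 2 * y) = y := by field_simp
    rw [← mul_pow, e]
  have h4 : Real.exp (-ε * y) = Real.exp (-(ε / 2 * y)) * Real.exp (-(ε / 2) * y) := by
    rw [← Real.exp_add]; congr 1; ring
  calc y ^ k * Real.exp (-ε * y) = (2 / ε) ^ k * (ε / 2 * y) ^ k * (Real.exp (-(ε / 2 * y)) * Real.exp (-(ε / 2) * y)) := by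
        rw [h2, h4]
    _ ≤ (2 / ε) ^ k * (Real.exp (ε / 2 * y) * k.factorial) * (Real.exp (-(ε / 2 * y)) * Real.exp (-(ε / 2) * y)) := by
        gcongr
    _ = k.factorial * (2 / ε) ^ k * Real.exp (-(ε / 2) * y) * (Real.exp (ε / 2 * y) * Real.exp (-(ε / 2 * y))) := by ring
    _ = k.factorial * (2 / ε) ^ k * Real.exp (-(ε / 2) * y) := by rw [← Real.exp_add, add_neg_cancel, Real.exp_zero, mul_one]

/-- [folklore] **Damped count.**  `Σ_{j∈T} e^{−εj} ≤ 1 + 1∕ε` for every finite `T ⊆ ℕ` (geometric series in `e^{−ε}`). -/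
theorem sum_exp_neg_le {ε : ℝ} (hε : 0 < ε) (T : Finset ℕ) : ∑ j ∈ T, Real.exp (-ε * j) ≤ 1 + 1 / ε := by
  set q : ℝ := Real.exp (-ε) with hq
  have hq0 : 0 ≤ q := (Real.exp_pos _).le
  have hq1 : q < 1 := Real.exp_lt_one_iff.mpr (by linarith)
  have hN : T ⊆ Finset.range (T.sup id + 1) := fun j hj =>
    Finset.mem_range.mpr (Nat.lt_succ_of_le (Finset.le_sup (f := id) hj))
  have hg := geom_sum_Ico_le_of_lt_one (m := 0) (n := T.sup id + 1) hq0 hq1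
  rw [pow_zero, ← Finset.range_eq_Ico] at hg
  have e : ∀ j : ℕ, Real.exp (-ε * j) = q ^ j := fun j => by rw [hq, ← Real.exp_nat_mul]; congr 1; ring
  calc ∑ j ∈ T, Real.exp (-ε * j) = ∑ j ∈ T, q ^ j := Finset.sum_congr rfl fun j _ => e j
    _ ≤ ∑ j ∈ Finset.range (T.sup id + 1), q ^ j := Finset.sum_le_sum_of_subset_of_nonneg hN fun j _ _ => pow_nonneg hq0 j
    _ ≤ 1 / (1 - q) := hg
    _ ≤ 1 + 1 / ε := by
        -- `1∕(1 − e^{−ε}) ≤ 1 + 1∕ε` from `1 + ε ≤ e^ε` (the pattern of `WindowInterface.tail_sum_le_exp`; the same inequality is the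
        -- tree's `HuxleyZeroDetection.inv_one_sub_exp_neg_le`, not imported to keep this module's closure inside the Beta tree)
        have h1 : q ≤ 1 / (1 + ε) := by
          rw [hq, Real.exp_neg, one_div]
          exact inv_anti₀ (by positivity) (by linarith [Real.add_one_le_exp ε])
        have h2 : ε / (1 + ε) ≤ 1 - q := by
          have : ε / (1 + ε) = 1 - 1 / (1 + ε) := by field_simp; ring
          linarith
        calc 1 / (1 - q) ≤ 1 / (ε / (1 + ε)) := one_div_le_one_div_of_le (by positivity) h2
          _ = 1 + 1 / ε := by field_simp; ring

/-- [folklore] **Damped moments.**  `Σ_{j∈T} j^k·e^{−εj} ≤ k!·(2∕ε)^k·(1 + 2∕ε)` for every finite `T ⊆ ℕ`, `ε > 0`. -/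
theorem sum_pow_mul_exp_neg_le {ε : ℝ} (hε : 0 < ε) (k : ℕ) (T : Finset ℕ) :
    ∑ j ∈ T, (j : ℝ) ^ k * Real.exp (-ε * j) ≤ k.factorial * (2 / ε) ^ k * (1 + 2 / ε) := by
  have h := sum_exp_neg_le (ε := ε / 2) (by positivity) T
  rw [one_div_div] at h
  calc ∑ j ∈ T, (j : ℝ) ^ k * Real.exp (-ε * j) ≤ ∑ j ∈ T, k.factorial * (2 / ε) ^ k * Real.exp (-(ε / 2) * j) :=
        Finset.sum_le_sum fun j _ => pow_mul_exp_neg_le hε k (Nat.cast_nonneg j)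
    _ = k.factorial * (2 / ε) ^ k * ∑ j ∈ T, Real.exp (-(ε / 2) * j) := by rw [Finset.mul_sum]
    _ ≤ k.factorial * (2 / ε) ^ k * (1 + 2 / ε) := mul_le_mul_of_nonneg_left h (by positivity)

/-- [folklore] **Damped harmonic sum.**  `Σ_{1≤j≤M} e^{−εj}∕j ≤ 1 + log N + (1 + 2∕ε)∕N` for every `N ≥ 1` (harmonic up to `N`, then
`1∕j ≤ 1∕N` and the damped count). -/
theorem sum_Icc_exp_div_le {ε : ℝ} (hε : 0 < ε) {N : ℕ} (hN : 1 ≤ N) (M : ℕ) :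
    ∑ j ∈ Finset.Icc 1 M, Real.exp (-ε * j) / (j : ℝ) ≤ 1 + Real.log N + (1 + 2 / ε) / N := by
  have hN0 : (0 : ℝ) < N := by exact_mod_cast hN
  rw [← Finset.sum_filter_add_sum_filter_not (Finset.Icc 1 M) (fun j => j ≤ N)]
  have hA : ∑ j ∈ (Finset.Icc 1 M).filter (fun j => j ≤ N), Real.exp (-ε * j) / (j : ℝ) ≤ 1 + Real.log N := by
    calc ∑ j ∈ (Finset.Icc 1 M).filter (fun j => j ≤ N), Real.exp (-ε * j) / (j : ℝ)
        ≤ ∑ j ∈ (Finset.Icc 1 M).filter (fun j => j ≤ N), 1 / (j : ℝ) := by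
          refine Finset.sum_le_sum fun j _ => div_le_div_of_nonneg_right ?_ (by positivity)
          exact Real.exp_le_one_iff.mpr (by nlinarith [Nat.cast_nonneg (α := ℝ) j])
      _ ≤ ∑ j ∈ Finset.Icc 1 N, 1 / (j : ℝ) := by
          refine Finset.sum_le_sum_of_subset_of_nonneg (fun j hj => ?_) fun j _ _ => by positivity
          rw [Finset.mem_filter, Finset.mem_Icc] at hj
          exact Finset.mem_Icc.mpr ⟨hj.1.1, hj.2⟩
      _ ≤ 1 + Real.log N := by
          have h := harmonic_le_one_add_log N
          rw [harmonic_eq_sum_Icc, Rat.cast_sum] at h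
          simpa [one_div] using h
  have hB : ∑ j ∈ (Finset.Icc 1 M).filter (fun j => ¬j ≤ N), Real.exp (-ε * j) / (j : ℝ) ≤ (1 + 2 / ε) / N := by
    calc ∑ j ∈ (Finset.Icc 1 M).filter (fun j => ¬j ≤ N), Real.exp (-ε * j) / (j : ℝ)
        ≤ ∑ j ∈ (Finset.Icc 1 M).filter (fun j => ¬j ≤ N), (j : ℝ) ^ 0 * Real.exp (-ε * j) * (1 / N) := by
          refine Finset.sum_le_sum fun j hj => ?_
          rw [Finset.mem_filter] at hj
          have hjN : (N : ℝ) ≤ j := by exact_mod_cast (not_le.mp hj.2).le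
          rw [pow_zero, one_mul, div_eq_mul_one_div]
          exact mul_le_mul_of_nonneg_left (one_div_le_one_div_of_le hN0 hjN) (Real.exp_pos _).le
      _ = (∑ j ∈ (Finset.Icc 1 M).filter (fun j => ¬j ≤ N), (j : ℝ) ^ 0 * Real.exp (-ε * j)) * (1 / N) := by
          rw [Finset.sum_mul]
      _ ≤ ((0 : ℕ).factorial * (2 / ε) ^ 0 * (1 + 2 / ε)) * (1 / N) :=
          mul_le_mul_of_nonneg_right (sum_pow_mul_exp_neg_le hε 0 _) (by positivity)
      _ = (1 + 2 / ε) / N := by rw [Nat.factorial_zero, Nat.cast_one, pow_zero, one_mul, one_mul, ← div_eq_mul_one_div]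
  linarith

/-! ## §2 Shells of an arbitrary finite set around any centre; radial majorants -/

/-- [folklore] The `j`-shell (`j ≥ 1`) of ANY finite set around ANY centre has at most `2d·3^{d−1}·j^{d−1}` points
(recentred `PoissonInterior.card_shell_le`, then `(2j+1)^{d−1} ≤ 3^{d−1}j^{d−1}`). -/
theorem card_shell_le' (hd : 0 < d) (S : Finset (Site d)) (u : Site d) {j : ℕ} (hj : 1 ≤ j) :
    ((S.filter (fun x => supNorm (x - u) = j)).card : ℝ) ≤ 2 * d * 3 ^ (d - 1) * (j : ℝ) ^ (d - 1) := by
  classical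
  have h1 : (S.filter (fun x => supNorm (x - u) = j)).card ≤
      ((cube (0 : Site d) j).filter (fun z => supNorm z = j)).card := by
    refine Finset.card_le_card_of_injOn (fun x => x - u) (fun x hx => ?_) (fun x _ y _ hxy => sub_left_injective hxy)
    rw [Finset.mem_coe, Finset.mem_filter] at hx
    rw [Finset.mem_coe, Finset.mem_filter, mem_cube_zero_iff]
    exact ⟨hx.2.le, hx.2⟩
  calc ((S.filter (fun x => supNorm (x - u) = j)).card : ℝ)
      ≤ (((cube (0 : Site d) j).filter (fun z => supNorm z = j)).card : ℝ) := by exact_mod_cast h1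
    _ ≤ 2 * d * (2 * j + 1) ^ (d - 1) := card_shell_le hd j j hj
    _ ≤ 2 * d * (3 ^ (d - 1) * (j : ℝ) ^ (d - 1)) := by gcongr; exact two_mul_add_one_pow_le hj _
    _ = _ := by ring

/-- [folklore] **RADIAL MAJORANT, no centre.**  For `φ ≥ 0` and a finite set all of whose points are at sup-distance `∈ [m, M]`
from `u` with `m ≥ 1`: `Σ_{x∈S} φ(‖x−u‖∞) ≤ 2d·3^{d−1}·Σ_{j=m}^{M} j^{d−1}·φ(j)`. -/
theorem sum_radial_le (hd : 0 < d) {φ : ℕ → ℝ} (hφ : ∀ j, 0 ≤ φ j) (S : Finset (Site d)) (u : Site d) {m M : ℕ}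
    (hm : 1 ≤ m) (hmS : ∀ x ∈ S, m ≤ supNorm (x - u)) (hMS : ∀ x ∈ S, supNorm (x - u) ≤ M) :
    ∑ x ∈ S, φ (supNorm (x - u)) ≤ 2 * d * 3 ^ (d - 1) * ∑ j ∈ Finset.Icc m M, (j : ℝ) ^ (d - 1) * φ j := by
  classical
  have hsub : S.image (fun x => supNorm (x - u)) ⊆ Finset.Icc m M := by
    intro j hj
    obtain ⟨x, hx, rfl⟩ := Finset.mem_image.mp hj
    exact Finset.mem_Icc.mpr ⟨hmS x hx, hMS x hx⟩
  rw [Finset.sum_comp, Finset.mul_sum]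
  refine le_trans (Finset.sum_le_sum fun j hj => ?_) (Finset.sum_le_sum_of_subset_of_nonneg hsub fun j _ _ => ?_)
  · have hj1 : 1 ≤ j := hm.trans (Finset.mem_Icc.mp (hsub hj)).1
    rw [nsmul_eq_mul, ← mul_assoc]
    exact mul_le_mul_of_nonneg_right (card_shell_le' hd S u hj1) (hφ j)
  · have := hφ j; positivity

/-- [folklore] **RADIAL MAJORANT, centre allowed.**  `Σ_{x∈S} φ(‖x−u‖∞) ≤ φ(0) + 2d·3^{d−1}·Σ_{j=1}^{M} j^{d−1}·φ(j)` for `φ ≥ 0` and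
`‖x−u‖∞ ≤ M` on `S`. -/
theorem sum_radial_le₀ (hd : 0 < d) {φ : ℕ → ℝ} (hφ : ∀ j, 0 ≤ φ j) (S : Finset (Site d)) (u : Site d) {M : ℕ}
    (hMS : ∀ x ∈ S, supNorm (x - u) ≤ M) :
    ∑ x ∈ S, φ (supNorm (x - u)) ≤ φ 0 + 2 * d * 3 ^ (d - 1) * ∑ j ∈ Finset.Icc 1 M, (j : ℝ) ^ (d - 1) * φ j := by
  classical
  rw [← Finset.sum_filter_add_sum_filter_not S (fun x => supNorm (x - u) = 0)]
  have h0 : ∑ x ∈ S.filter (fun x => supNorm (x - u) = 0), φ (supNorm (x - u)) ≤ φ 0 := by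
    have hS₀ : S.filter (fun x => supNorm (x - u) = 0) ⊆ {u} := by
      intro x hx
      rw [Finset.mem_filter] at hx
      exact Finset.mem_singleton.mpr (sub_eq_zero.mp (supNorm_eq_zero_iff.mp hx.2))
    calc ∑ x ∈ S.filter (fun x => supNorm (x - u) = 0), φ (supNorm (x - u))
        ≤ ∑ x ∈ ({u} : Finset (Site d)), φ (supNorm (x - u)) := Finset.sum_le_sum_of_subset_of_nonneg hS₀ fun _ _ _ => hφ _
      _ = φ 0 := by rw [Finset.sum_singleton, sub_self, supNorm_zero]
  have h1 := sum_radial_le hd hφ (S.filter (fun x => ¬supNorm (x - u) = 0)) u le_rfl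
    (fun x hx => Nat.one_le_iff_ne_zero.mpr (Finset.mem_filter.mp hx).2) (fun x hx => hMS x (Finset.mem_filter.mp hx).1) (M := M)
  linarith

/-- [folklore] Every finite set has a radius: `‖x−u‖∞ ≤ S.sup (‖·−u‖∞)` on `S`. -/
theorem supNorm_le_sup (S : Finset (Site d)) (u : Site d) {x : Site d} (hx : x ∈ S) :
    supNorm (x - u) ≤ S.sup (fun y => supNorm (y - u)) :=
  Finset.le_sup (f := fun y => supNorm (y - u)) hx

/-- [folklore] `nrm v = max(1, ‖v‖∞)` read through a function of the integer sup-norm. -/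
theorem nrm_eq_max (v : Site d) : nrm v = max 1 ((supNorm v : ℕ) : ℝ) := rfl

/-- [folklore] For `j ≥ 1`: `max(1, j) = j`. -/
theorem max_one_cast {j : ℕ} (hj : 1 ≤ j) : max (1 : ℝ) (j : ℝ) = j :=
  max_eq_right (by exact_mod_cast hj)

/-! ## §3 One centre -/

/-- [folklore] **SUB-CRITICAL WINDOW** (recentred `sum_cube_inv_nrm_pow_le`): for `p ≤ d−1` and `‖x−u‖∞ ≤ R` on `S`,
`Σ_{x∈S} nrm(x−u)^{−p} ≤ 1 + 2d·3^{d−1}·R^{d−p}`. -/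
theorem sum_inv_nrm_pow_le (hd : 0 < d) {p : ℕ} (hp : p ≤ d - 1) (S : Finset (Site d)) (u : Site d) {R : ℕ}
    (hR : ∀ x ∈ S, supNorm (x - u) ≤ R) :
    ∑ x ∈ S, 1 / nrm (x - u) ^ p ≤ 1 + 2 * d * 3 ^ (d - 1) * (R : ℝ) ^ (d - p) := by
  classical
  have e : ∑ x ∈ S, 1 / nrm (x - u) ^ p = ∑ z ∈ S.image (fun x => x - u), 1 / nrm z ^ p := by
    rw [Finset.sum_image fun x _ y _ h => sub_left_injective h]
  rw [e]
  calc ∑ z ∈ S.image (fun x => x - u), 1 / nrm z ^ p ≤ ∑ z ∈ cube (0 : Site d) R, 1 / nrm z ^ p := by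
        refine Finset.sum_le_sum_of_subset_of_nonneg (fun z hz => ?_) fun z _ _ => by
          have := nrm_pos z; positivity
        obtain ⟨x, hx, rfl⟩ := Finset.mem_image.mp hz
        exact mem_cube_zero_iff.mpr (hR x hx)
    _ ≤ _ := sum_cube_inv_nrm_pow_le hd R p hp

/-- [folklore] **CRITICAL WINDOW** `p = d`: `Σ_{x∈S, ‖x−u‖∞≤R} nrm(x−u)^{−d} ≤ 1 + 2d·3^{d−1}·(1 + log R)`. -/
theorem sum_inv_nrm_pow_crit_le (hd : 0 < d) (S : Finset (Site d)) (u : Site d) {R : ℕ}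
    (hR : ∀ x ∈ S, supNorm (x - u) ≤ R) :
    ∑ x ∈ S, 1 / nrm (x - u) ^ d ≤ 1 + 2 * d * 3 ^ (d - 1) * (1 + Real.log R) := by
  have hφ : ∀ j : ℕ, 0 ≤ 1 / (max (1 : ℝ) (j : ℝ)) ^ d := fun j => by positivity
  have h := sum_radial_le₀ hd hφ S u hR
  simp only [Nat.cast_zero, max_eq_left (zero_le_one' ℝ), one_pow, div_one] at h
  refine le_trans h (add_le_add le_rfl (mul_le_mul_of_nonneg_left ?_ (by positivity)))
  -- harmonic bound `Σ_{1≤j≤R} 1∕j ≤ 1 + log R` (Mathlib's `harmonic_le_one_add_log`, cast to `ℝ`; = the tree's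
  -- `Montgomery.sum_Icc_one_div_le_log`, not imported to keep the closure inside the Beta tree)
  have hharm : ∑ j ∈ Finset.Icc 1 R, 1 / (j : ℝ) ≤ 1 + Real.log R := by
    have h := harmonic_le_one_add_log R
    rw [harmonic_eq_sum_Icc, Rat.cast_sum] at h
    simpa [one_div] using h
  refine le_trans (Finset.sum_le_sum fun j hj => ?_) hharm
  have hj1 : 1 ≤ j := (Finset.mem_Icc.mp hj).1
  have hj0 : (0 : ℝ) < j := by exact_mod_cast hj1
  have e : (j : ℝ) ^ d = (j : ℝ) ^ (d - 1) * j := by rw [← pow_succ, Nat.sub_add_cancel hd]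
  rw [max_one_cast hj1, e]
  exact le_of_eq (by field_simp)

/-- [folklore] **SUPER-CRITICAL TAIL** `p ≥ d+1`: if `‖x−u‖∞ ≥ m ≥ 1` on `S` then `Σ_{x∈S} nrm(x−u)^{−p} ≤ 4d·3^{d−1}∕m^{p−d}`. -/
theorem sum_inv_nrm_pow_tail_le (hd : 0 < d) {p : ℕ} (hp : d + 1 ≤ p) (S : Finset (Site d)) (u : Site d) {m : ℕ}
    (hm : 1 ≤ m) (hmS : ∀ x ∈ S, m ≤ supNorm (x - u)) :
    ∑ x ∈ S, 1 / nrm (x - u) ^ p ≤ 4 * d * 3 ^ (d - 1) / (m : ℝ) ^ (p - d) := by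
  have hm0 : (0 : ℝ) < m := by exact_mod_cast hm
  have hφ : ∀ j : ℕ, 0 ≤ 1 / (max (1 : ℝ) (j : ℝ)) ^ p := fun j => by positivity
  refine le_trans (sum_radial_le hd hφ S u hm hmS (fun x hx => supNorm_le_sup S u hx)) ?_
  set M := S.sup (fun y => supNorm (y - u))
  have hpt : ∀ j ∈ Finset.Icc m M, (j : ℝ) ^ (d - 1) * (1 / (max (1 : ℝ) (j : ℝ)) ^ p) ≤ 1 / (m : ℝ) ^ (p - d - 1) * (1 / (j : ℝ) ^ 2) := by
    intro j hj
    have hmj : m ≤ j := (Finset.mem_Icc.mp hj).1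
    have hj1 : 1 ≤ j := hm.trans hmj
    have hj0 : (0 : ℝ) < j := by exact_mod_cast hj1
    have hmj' : (m : ℝ) ≤ j := by exact_mod_cast hmj
    have hsplit : (j : ℝ) ^ p = (j : ℝ) ^ (d - 1) * ((j : ℝ) ^ (p - d - 1) * (j : ℝ) ^ 2) := by
      rw [← pow_add, ← pow_add]; congr 1; omega
    rw [max_one_cast hj1, hsplit]
    calc (j : ℝ) ^ (d - 1) * (1 / ((j : ℝ) ^ (d - 1) * ((j : ℝ) ^ (p - d - 1) * (j : ℝ) ^ 2)))
        = 1 / (j : ℝ) ^ (p - d - 1) * (1 / (j : ℝ) ^ 2) := by field_simp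
      _ ≤ 1 / (m : ℝ) ^ (p - d - 1) * (1 / (j : ℝ) ^ 2) := by gcongr
  have e : (m : ℝ) ^ (p - d) = (m : ℝ) ^ (p - d - 1) * m := by rw [← pow_succ]; congr 1; omega
  calc 2 * d * 3 ^ (d - 1) * ∑ j ∈ Finset.Icc m M, (j : ℝ) ^ (d - 1) * (1 / (max (1 : ℝ) (j : ℝ)) ^ p)
      ≤ 2 * d * 3 ^ (d - 1) * ∑ j ∈ Finset.Icc m M, 1 / (m : ℝ) ^ (p - d - 1) * (1 / (j : ℝ) ^ 2) :=
        mul_le_mul_of_nonneg_left (Finset.sum_le_sum hpt) (by positivity)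
    _ = 2 * d * 3 ^ (d - 1) * (1 / (m : ℝ) ^ (p - d - 1)) * ∑ j ∈ Finset.Icc m M, 1 / (j : ℝ) ^ 2 := by
        rw [Finset.mul_sum, Finset.mul_sum]
        exact Finset.sum_congr rfl fun j _ => by ring
    _ ≤ 2 * d * 3 ^ (d - 1) * (1 / (m : ℝ) ^ (p - d - 1)) * (2 / (m : ℝ)) :=
        mul_le_mul_of_nonneg_left (sum_Icc_inv_sq_le hm M) (by positivity)
    _ = 4 * d * 3 ^ (d - 1) / (m : ℝ) ^ (p - d) := by rw [e]; field_simp; ring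

/-- [folklore] **SUPER-CRITICAL, WHOLE SPACE** `p ≥ d+1`: `Σ_{x∈S} nrm(x−u)^{−p} ≤ 1 + 4d·3^{d−1}` for every finite `S`. -/
theorem sum_inv_nrm_pow_le_const (hd : 0 < d) {p : ℕ} (hp : d + 1 ≤ p) (S : Finset (Site d)) (u : Site d) :
    ∑ x ∈ S, 1 / nrm (x - u) ^ p ≤ 1 + 4 * d * 3 ^ (d - 1) := by
  classical
  rw [← Finset.sum_filter_add_sum_filter_not S (fun x => supNorm (x - u) = 0)]
  have h0 : ∑ x ∈ S.filter (fun x => supNorm (x - u) = 0), 1 / nrm (x - u) ^ p ≤ 1 := by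
    have hS₀ : S.filter (fun x => supNorm (x - u) = 0) ⊆ {u} := by
      intro x hx
      rw [Finset.mem_filter] at hx
      exact Finset.mem_singleton.mpr (sub_eq_zero.mp (supNorm_eq_zero_iff.mp hx.2))
    calc ∑ x ∈ S.filter (fun x => supNorm (x - u) = 0), 1 / nrm (x - u) ^ p
        ≤ ∑ x ∈ ({u} : Finset (Site d)), 1 / nrm (x - u) ^ p :=
          Finset.sum_le_sum_of_subset_of_nonneg hS₀ fun x _ _ => by have := nrm_pos (x - u); positivity
      _ = 1 := by rw [Finset.sum_singleton, sub_self, nrm_eq_max, supNorm_zero]; simp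
  have h1 := sum_inv_nrm_pow_tail_le hd hp (S.filter (fun x => ¬supNorm (x - u) = 0)) u le_rfl
    (fun x hx => Nat.one_le_iff_ne_zero.mpr (Finset.mem_filter.mp hx).2)
  rw [Nat.cast_one, one_pow, div_one] at h1
  linarith

/-! ## §4 Damped one-centre sums (mass `ε`; at `ε = δ∕n` these are the scale-`n` moment sums) -/

/-- [folklore] **DAMPED MOMENTS**: `Σ_{x∈S} ‖x−u‖∞^q·e^{−ε‖x−u‖∞} ≤ 1 + 2d·3^{d−1}·(q+d−1)!·(2∕ε)^{q+d−1}·(1+2∕ε)`. -/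
theorem sum_pow_mul_exp_le (hd : 0 < d) {ε : ℝ} (hε : 0 < ε) (q : ℕ) (S : Finset (Site d)) (u : Site d) :
    ∑ x ∈ S, ((supNorm (x - u) : ℕ) : ℝ) ^ q * Real.exp (-ε * supNorm (x - u))
      ≤ 1 + 2 * d * 3 ^ (d - 1) * ((q + d - 1).factorial * (2 / ε) ^ (q + d - 1) * (1 + 2 / ε)) := by
  have hφ : ∀ j : ℕ, 0 ≤ (j : ℝ) ^ q * Real.exp (-ε * j) := fun j => by positivity
  refine le_trans (sum_radial_le₀ hd hφ S u (fun x hx => supNorm_le_sup S u hx)) (add_le_add ?_ ?_)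
  · rw [Nat.cast_zero, mul_zero, Real.exp_zero, mul_one]
    exact pow_le_one₀ le_rfl zero_le_one
  · refine mul_le_mul_of_nonneg_left (le_trans (le_of_eq (Finset.sum_congr rfl fun j _ => ?_)) (sum_pow_mul_exp_neg_le hε _ _))
      (by positivity)
    have : (j : ℝ) ^ (q + d - 1) = (j : ℝ) ^ (d - 1) * (j : ℝ) ^ q := by rw [← pow_add]; congr 1; omega
    rw [this, mul_assoc]

/-- [folklore] **DAMPED MOMENTS AT SCALE `n`** (`ε = δ∕n`, `n ≥ 1`): `Σ_{x∈S} ‖x−u‖∞^q·e^{−(δ∕n)‖x−u‖∞} ≤ 1 + C(d,q,δ)·n^{q+d}` with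
`C = 2d·3^{d−1}·(q+d−1)!·(2∕δ)^{q+d−1}·(1+2∕δ)` — the saturated sums `Σ_w|w|²e^{−δ|w|∕n} ≍ n⁶` (d = 4, q = 2) of the T-ledgers. -/
theorem sum_pow_mul_exp_scale_le (hd : 0 < d) {δ : ℝ} (hδ : 0 < δ) {n : ℕ} (hn : 1 ≤ n) (q : ℕ) (S : Finset (Site d)) (u : Site d) :
    ∑ x ∈ S, ((supNorm (x - u) : ℕ) : ℝ) ^ q * Real.exp (-(δ / n) * supNorm (x - u))
      ≤ 1 + 2 * d * 3 ^ (d - 1) * ((q + d - 1).factorial * (2 / δ) ^ (q + d - 1) * (1 + 2 / δ)) * (n : ℝ) ^ (q + d) := by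
  have hn0 : (0 : ℝ) < n := by exact_mod_cast hn
  have hn1 : (1 : ℝ) ≤ n := by exact_mod_cast hn
  refine le_trans (sum_pow_mul_exp_le hd (ε := δ / n) (by positivity) q S u) (add_le_add le_rfl ?_)
  have e1 : (2 : ℝ) / (δ / n) = 2 / δ * n := by field_simp
  have h2δ : (0 : ℝ) ≤ 2 / δ := by positivity
  have e2 : (1 : ℝ) + 2 / δ * n ≤ (1 + 2 / δ) * n := by nlinarith
  rw [e1, mul_pow]
  calc 2 * d * 3 ^ (d - 1) * ((q + d - 1).factorial * ((2 / δ) ^ (q + d - 1) * (n : ℝ) ^ (q + d - 1)) * (1 + 2 / δ * n))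
      ≤ 2 * d * 3 ^ (d - 1) * ((q + d - 1).factorial * ((2 / δ) ^ (q + d - 1) * (n : ℝ) ^ (q + d - 1)) * ((1 + 2 / δ) * n)) := by
        gcongr
    _ = 2 * d * 3 ^ (d - 1) * ((q + d - 1).factorial * (2 / δ) ^ (q + d - 1) * (1 + 2 / δ)) * ((n : ℝ) ^ (q + d - 1) * n) := by
        ring
    _ = _ := by rw [← pow_succ, show q + d - 1 + 1 = q + d by omega]

/-- [folklore] **DAMPED SUB-CRITICAL POWERS** `p ≤ d−1`: `Σ_{x∈S} e^{−ε‖x−u‖∞}∕nrm(x−u)^p ≤ 1 + 2d·3^{d−1}·(d−1−p)!·(2∕ε)^{d−1−p}·(1+2∕ε)`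
(at `ε = δ∕n`, `n ≥ 1`, `(2∕ε)^{d−1−p}(1+2∕ε) ≤ (2∕δ)^{d−1−p}(1+2∕δ)·n^{d−p}` — e.g. `Σ_w nrm(w)⁻²e^{−δ|w|∕n} ≍ n²` in `d = 4`). -/
theorem sum_exp_div_nrm_pow_le (hd : 0 < d) {ε : ℝ} (hε : 0 < ε) {p : ℕ} (hp : p ≤ d - 1) (S : Finset (Site d)) (u : Site d) :
    ∑ x ∈ S, Real.exp (-ε * supNorm (x - u)) / nrm (x - u) ^ p
      ≤ 1 + 2 * d * 3 ^ (d - 1) * ((d - 1 - p).factorial * (2 / ε) ^ (d - 1 - p) * (1 + 2 / ε)) := by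
  have hφ : ∀ j : ℕ, 0 ≤ Real.exp (-ε * j) / (max (1 : ℝ) (j : ℝ)) ^ p := fun j => by positivity
  refine le_trans (sum_radial_le₀ hd hφ S u (fun x hx => supNorm_le_sup S u hx)) (add_le_add (by simp) ?_)
  refine mul_le_mul_of_nonneg_left (le_trans (Finset.sum_le_sum fun j hj => ?_) (sum_pow_mul_exp_neg_le hε _ _)) (by positivity)
  have hj1 : 1 ≤ j := (Finset.mem_Icc.mp hj).1
  have hj0 : (0 : ℝ) < j := by exact_mod_cast hj1
  have e : (j : ℝ) ^ (d - 1) = (j : ℝ) ^ (d - 1 - p) * (j : ℝ) ^ p := by rw [← pow_add]; congr 1; omega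
  rw [max_one_cast hj1, e]
  exact le_of_eq (by field_simp)

/-- [folklore] **DAMPED CRITICAL POWER** `p = d` at scale `n`: `Σ_{x∈S} e^{−(δ∕n)‖x−u‖∞}∕nrm(x−u)^d ≤ 1 + 2d·3^{d−1}·(2 + 2∕δ + log n)` —
the `log n` of a marginal kernel cut off smoothly at the block scale. -/
theorem sum_exp_div_nrm_pow_crit_le (hd : 0 < d) {δ : ℝ} (hδ : 0 < δ) {n : ℕ} (hn : 1 ≤ n) (S : Finset (Site d)) (u : Site d) :
    ∑ x ∈ S, Real.exp (-(δ / n) * supNorm (x - u)) / nrm (x - u) ^ d ≤ 1 + 2 * d * 3 ^ (d - 1) * (2 + 2 / δ + Real.log n) := by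
  have hn0 : (0 : ℝ) < n := by exact_mod_cast hn
  have hε : (0 : ℝ) < δ / n := by positivity
  have hφ : ∀ j : ℕ, 0 ≤ Real.exp (-(δ / n) * j) / (max (1 : ℝ) (j : ℝ)) ^ d := fun j => by positivity
  refine le_trans (sum_radial_le₀ hd hφ S u (fun x hx => supNorm_le_sup S u hx)) (add_le_add (by simp) ?_)
  refine mul_le_mul_of_nonneg_left (le_trans (Finset.sum_le_sum fun j hj => ?_) (le_trans (sum_Icc_exp_div_le hε hn _) ?_))
    (by positivity)
  · have hj1 : 1 ≤ j := (Finset.mem_Icc.mp hj).1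
    have hj0 : (0 : ℝ) < j := by exact_mod_cast hj1
    have e : (j : ℝ) ^ d = (j : ℝ) ^ (d - 1) * j := by rw [← pow_succ, Nat.sub_add_cancel hd]
    rw [max_one_cast hj1, e]
    exact le_of_eq (by field_simp)
  · have e : (1 + 2 / (δ / n)) / n = 1 / n + 2 / δ := by field_simp
    have h1 : 1 / (n : ℝ) ≤ 1 := by rw [div_le_one hn0]; exact_mod_cast hn
    rw [e]; linarith

end Summit.QuantumFields.BalabanUV.Beta.D1BFx.LatticeHLSRadial
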